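import Summits.BirchSwinnertonDyer.BirchSwinnertonDyer.Theorems.ManinLocalTwoThreePinningOneFortyFourRows
import Summits.BirchSwinnertonDyer.BirchSwinnertonDyer.Theorems.ManinLocalTwoThreeNeronSqueezeOneFortyFour
import Summits.BirchSwinnertonDyer.BirchSwinnertonDyer.Theorems.ManinLocalTwoThreeTwistDefectRootDatum
import Summits.BirchSwinnertonDyer.BirchSwinnertonDyer.Theorems.ManinLocalTwoThreeExistsMinimalOptimalDatum
import Literature.NumberTheory.EllipticCurves.CuspFormTwist
import Literature.NumberTheory.EllipticCurves.QuadraticTwistNegOneLFunctionProofs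
import HarnessLib

/-!
# Level 144 = 2⁴·3² (BOTH crux domains: C2 `4 ∣ 144` AND C3 `9 ∣ 144`; genus 13; two classes `144a`, `144b`) COMPLETE: `|c| = 1` — hence `2 ∤ c` and
# `3 ∤ c` — for EVERY lattice-optimal `X₀(144)`-datum of EVERY globally minimal elliptic curve over `ℚ`, UNCONDITIONALLY

Cell `bsd-f2-manin`, route `ManinLocalTwoThree`, cruxes C2 `ManinOddAtFour` (stmt-BirchSwinnertonDyer-22967: `2² ∣ 144`) and C3 `ManinPrimeToThreeAtNine`
(stmt-BirchSwinnertonDyer-22968: `3² ∣ 144`); prover seat p2 gen 31; `--supports` (helper).  ASSEMBLY of three roads of the cell: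
* an g55's FACT-FREE kernel pinning of level `144` (`…PinningOneFortyFour{Tables,TablesB,TablesC,}`: `36` sparse `η`-certificates to depth `128`, staged sieve,
  Fricke sieve) and its row identification `PinningOneFortyFour.coe_f_eq_eta_or_f_eq_charTwist`: for every `X₀(144)`-datum `D`, either
  `⇑D.f = φ₁₄₄ₐ = η₁₂¹²/(η₆η₂₄)⁴` (class `144a`) or `D.f = (φ₇₂)^{χ₋₄}` as the tree's `charTwist` (class `144b`), for any `φ ∈ S₂(Γ₀(72))` with
  `⇑φ = φ₇₂ = ⅔·η₄⁴η₆²/η₂² + ⅓·η₂⁴η₁₂²/η₄²` (such a `φ` exists: `PinningOneFortyFour.exists_phi72`);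
* p3's Néron squeeze for `144a` (`NeronSqueezeOneFortyFour.abs_maninConstant_eq_one_oneFortyFour_of_f_eq`: weight-4 `E₂`-road, `(S2)₁₄₄ₐ` with the Néron
  lattice of `144a1 = [0,0,0,0,−1]`);
* desc's twist-defect squeeze transport for `144b` in its `charTwist` form (`TwistDefect.abs_maninConstant_eq_one_oneFortyFourB_of_charTwist`, part 7
  `…TwistDefectRootDatum`: root `72a`, aligned `χ₋₄`-edge `72a1 ⊗ (−1) = 144b1`, `(S2)₇₂` = p3's `periodLatticeLe_seventyTwo`, `a₂ₖ(φ₇₂) = 0` = η-parity),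
  fed VERBATIM with an's row `D.f = charTwist 144 _ _ χ₋₄ φ`.
RESULTS: `abs_maninConstant_eq_one_oneFortyFour` (`|c| = 1` on all of `X₀(144)`), `not_two_dvd_…`, `not_three_dvd_…`, `not_prime_dvd_…`,
`maninOddAtFour_oneFortyFour : 2² ∣ 144 ∧ ∀ W D, hopt → |c| = 1 ∧ 2 ∤ c`, `maninPrimeToThreeAtNine_oneFortyFour : 3² ∣ 144 ∧ ∀ W D, hopt → |c| = 1 ∧ 3 ∤ c`,
and the domain is inhabited under the items' binder `exists_isNewformOf` (p3's `N(144a1) = 144`).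
HONEST FRAMING: unconditional (standard axioms); ONE level — the first level `2⁴·3²` treated in both crux domains at once — nothing here proves C2 or C3
for all `N`, Manin's conjecture or BSD; items 22967 / 22968 stay OPEN as filed.
[cite: Manin1972, Prop. 1.4] [cite: AgasheRibetStein2006, §§1–2] [cite: CremonaAlgorithms1997, §2.10, Table 1 (72a1, 144a1, 144b1), Table 3 (N = 144)]
[cite: Shimura1971, Prop. 3.64] [cite: Stevens1989, Lemma (5.4) p. 97] [cite: EdixhovenManin1991, Prop. 2] [cite: MartinOno1997, Thm. 2]
-/

set_option autoImplicit false
-- lint-debt: the directory name repeats the summit name (sibling precedent `ManinLocalTwoThreeManinConstantOneTwentyEight.lean`)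
set_option linter.dupNamespace false

noncomputable section

open Complex Filter Topology Set Function
open UpperHalfPlane hiding I
open scoped Real Topology MatrixGroups ModularForm
open ModularForm CongruenceSubgroup
open Literature.NumberTheory.ModularForms
open Literature.NumberTheory.EllipticCurves Literature.NumberTheory.EllipticCurves.ModularForms
open Literature.NumberTheory.Automorphic

namespace Summit.BirchSwinnertonDyer.BirchSwinnertonDyer.Theorems.ManinLocalTwoThree.LevelOneFortyFour

open TwistDefect PinningOneFortyFour

/-! ## §1 The headline: `|c| = 1` on all of `X₀(144)` -/

/-- **`|c| = 1` FOR EVERY LATTICE-OPTIMAL `X₀(144)`-DATUM of every globally minimal elliptic curve over `ℚ`** — UNCONDITIONAL: an's two rows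
(`144a`: `⇑D.f = η₁₂¹²/(η₆η₂₄)⁴` ↦ p3's squeeze; `144b`: `D.f = (φ₇₂)^{χ₋₄}` ↦ desc's transport). [cite: Manin1972, Prop. 1.4] [cite: AgasheRibetStein2006, §§1–2]
[cite: CremonaAlgorithms1997, Table 1 (144a1, 144b1)] -/
theorem abs_maninConstant_eq_one_oneFortyFour (W : WeierstrassCurve ℚ) [W.IsElliptic] [W.IsGloballyMinimal]
    (D : ModularParametrizationData W 144) (hopt : ∀ z ∈ D.L.lattice, ∃ w ∈ periodLattice D.f, z = D.c * w) :
    |D.maninConstant| = 1 := by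
  obtain ⟨φ, hφ⟩ := exists_phi72
  rcases coe_f_eq_eta_or_f_eq_charTwist D φ hφ with hf | hpin
  · exact NeronSqueezeOneFortyFour.abs_maninConstant_eq_one_oneFortyFour_of_f_eq W D hf hopt
  · exact abs_maninConstant_eq_one_oneFortyFourB_of_charTwist φ hφ W D hpin hopt

/-- **C2 `ManinOddAtFour` at `N = 144` (`2² ∣ 144`): `2 ∤ c(D)`** for every lattice-optimal `X₀(144)`-datum — UNCONDITIONAL. [cite: AgasheRibetStein2006, §§1–2] -/
theorem not_two_dvd_maninConstant_oneFortyFour (W : WeierstrassCurve ℚ) [W.IsElliptic] [W.IsGloballyMinimal]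
    (D : ModularParametrizationData W 144) (hopt : ∀ z ∈ D.L.lattice, ∃ w ∈ periodLattice D.f, z = D.c * w) :
    ¬ (2 : ℤ) ∣ D.maninConstant := by
  have h := abs_maninConstant_eq_one_oneFortyFour W D hopt
  intro h2
  have := Int.le_of_dvd (by rw [h]; norm_num) ((dvd_abs _ _).mpr h2)
  rw [h] at this
  norm_num at this

/-- **C3 `ManinPrimeToThreeAtNine` at `N = 144` (`3² ∣ 144`): `3 ∤ c(D)`** for every lattice-optimal `X₀(144)`-datum — UNCONDITIONAL.
[cite: AgasheRibetStein2006, §§1–2] -/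
theorem not_three_dvd_maninConstant_oneFortyFour (W : WeierstrassCurve ℚ) [W.IsElliptic] [W.IsGloballyMinimal]
    (D : ModularParametrizationData W 144) (hopt : ∀ z ∈ D.L.lattice, ∃ w ∈ periodLattice D.f, z = D.c * w) :
    ¬ (3 : ℤ) ∣ D.maninConstant := by
  have h := abs_maninConstant_eq_one_oneFortyFour W D hopt
  intro h3
  have := Int.le_of_dvd (by rw [h]; norm_num) ((dvd_abs _ _).mpr h3)
  rw [h] at this
  norm_num at this

/-- **No prime divides `c` on `X₀(144)`.** [cite: AgasheRibetStein2006, §§1–2] -/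
theorem not_prime_dvd_maninConstant_oneFortyFour (W : WeierstrassCurve ℚ) [W.IsElliptic] [W.IsGloballyMinimal]
    (D : ModularParametrizationData W 144) (hopt : ∀ z ∈ D.L.lattice, ∃ w ∈ periodLattice D.f, z = D.c * w)
    {p : ℕ} (hp : p.Prime) : ¬ (p : ℤ) ∣ D.maninConstant := by
  have h := abs_maninConstant_eq_one_oneFortyFour W D hopt
  intro hpd
  have h1 := Int.le_of_dvd (by rw [h]; norm_num) ((dvd_abs _ _).mpr hpd)
  rw [h] at h1
  have := hp.two_le
  omega

/-! ## §2 The two crux shapes on the whole `X₀(144)`-domain -/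

/-- **The C2 conclusion on the whole `X₀(144)`-domain**: `2² ∣ 144`, and `|c| = 1 ∧ 2 ∤ c` for every lattice-optimal `X₀(144)`-datum of every globally minimal
elliptic curve over `ℚ` — UNCONDITIONAL; BSD and C2 for general `N` are NOT proved by this. [folklore] -/
theorem maninOddAtFour_oneFortyFour :
    2 ^ 2 ∣ 144 ∧ ∀ (W : WeierstrassCurve ℚ) [W.IsElliptic] [W.IsGloballyMinimal] (D : ModularParametrizationData W 144),
      (∀ z ∈ D.L.lattice, ∃ w ∈ periodLattice D.f, z = D.c * w) → |D.maninConstant| = 1 ∧ ¬ (2 : ℤ) ∣ D.maninConstant :=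
  ⟨⟨36, by norm_num⟩, fun W _ _ D hopt ↦ ⟨abs_maninConstant_eq_one_oneFortyFour W D hopt, not_two_dvd_maninConstant_oneFortyFour W D hopt⟩⟩

/-- **The C3 conclusion on the whole `X₀(144)`-domain**: `3² ∣ 144`, and `|c| = 1 ∧ 3 ∤ c` for every lattice-optimal `X₀(144)`-datum of every globally minimal
elliptic curve over `ℚ` — UNCONDITIONAL; BSD and C3 for general `N` are NOT proved by this. [folklore] -/
theorem maninPrimeToThreeAtNine_oneFortyFour :
    3 ^ 2 ∣ 144 ∧ ∀ (W : WeierstrassCurve ℚ) [W.IsElliptic] [W.IsGloballyMinimal] (D : ModularParametrizationData W 144),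
      (∀ z ∈ D.L.lattice, ∃ w ∈ periodLattice D.f, z = D.c * w) → |D.maninConstant| = 1 ∧ ¬ (3 : ℤ) ∣ D.maninConstant :=
  ⟨⟨16, by norm_num⟩, fun W _ _ D hopt ↦ ⟨abs_maninConstant_eq_one_oneFortyFour W D hopt, not_three_dvd_maninConstant_oneFortyFour W D hopt⟩⟩

/-! ## §3 The domain is inhabited under the items' binder `exists_isNewformOf` -/

/-- **A lattice-optimal `X₀(144)`-datum on a globally minimal model in the class `144a` exists under modularity**, with `|c| = 1`, `2 ∤ c` and `3 ∤ c`;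
CONDITIONAL on `exists_isNewformOf` only (p3's `exists_isNewformOf_oneFortyFourA1`: `N(144a1) = 144` by kernel Tate certificate). [cite: EdixhovenManin1991, Prop. 2] -/
theorem domain_inhabited_oneFortyFour_of_modularity (hnf : exists_isNewformOf) :
    ∃ (W₀ : WeierstrassCurve ℚ) (_ : W₀.IsElliptic) (_ : W₀.IsGloballyMinimal) (D₀ : ModularParametrizationData W₀ 144),
      (⟨0, 0, 0, 0, -1⟩ : WeierstrassCurve ℚ).IsIsogenous W₀ ∧ (∀ z ∈ D₀.L.lattice, ∃ w ∈ periodLattice D₀.f, z = D₀.c * w) ∧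
      |D₀.maninConstant| = 1 ∧ ¬ (2 : ℤ) ∣ D₀.maninConstant ∧ ¬ (3 : ℤ) ∣ D₀.maninConstant := by
  haveI := NeronSqueezeOneFortyFour.isElliptic_oneFortyFourA1
  haveI : NeZero (144 : ℕ) := ⟨by decide⟩
  obtain ⟨f, hf⟩ := NeronSqueezeOneFortyFour.exists_isNewformOf_oneFortyFourA1 hnf
  obtain ⟨D⟩ := nonempty_modularParametrizationData_of_isNewformOf hf
  obtain ⟨W₀, h₀, hmin, D₀, -, hiso, hopt, -⟩ :=
    ExistsMinimalOptimalDatum.existsMinimalOptimalDatum_full (⟨0, 0, 0, 0, -1⟩ : WeierstrassCurve ℚ) D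
  exact ⟨W₀, h₀, hmin, D₀, hiso, hopt, @abs_maninConstant_eq_one_oneFortyFour W₀ h₀ hmin D₀ hopt,
    @not_two_dvd_maninConstant_oneFortyFour W₀ h₀ hmin D₀ hopt, @not_three_dvd_maninConstant_oneFortyFour W₀ h₀ hmin D₀ hopt⟩

end Summit.BirchSwinnertonDyer.BirchSwinnertonDyer.Theorems.ManinLocalTwoThree.LevelOneFortyFour

end
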